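import Summits.CriticalPhenomena.PercolationContinuityZ3.Theorems.Transplant.PlanarSkeletonFrmRayHolds
import Summits.CriticalPhenomena.PercolationContinuityZ3.Theorems.Transplant.PlanarSkeletonFrmOfBaseOne
import Summits.CriticalPhenomena.PercolationContinuityZ3.Theorems.Transplant.LineSkeletonSign
import Summits.CriticalPhenomena.PercolationContinuityZ3.Theorems.Transplant.PlanarSkeletonConcBoxProd
import Literature.Probability.Percolation.ThetaContinuityGraphCriterion
import HarnessLib

/-!
# THE INPUT SENTENCE OF RECORD FOR THE WHOLE D″ CLASS (gen 15), UNBUNDLED: `θ_v(p_c) = 0` everywhere from a chart, finitely many base vertices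
# with translating frames, and — at EACH BASE VERTEX — four unit steps, a connected unit cylinder, a chart inversion and an axis flip

builds on p205010 (kernel theorem, internal audit signed; external expert review pending): the unconditional theorems run through the CLOSED multi-type
D″ node `samePDropOfSkeletonSign_holds` (near-one gluing builds on p205010) and gen 15's Φ2 theorem `PlanarSkeletonFrm.cylSubcritical_criticalProb_ray`.
The `{±1}` version (no flip) is modulo the OPEN multi-type node `SamePDropOfSkeletonNeg` (hypothesis; nothing is claimed about it).
Lane `prim-bschramm`, seat `prim-bschramm-p4` gen 15 (PART C3 of `P4-GENERAL.md`, §37).  Helper file (`--supports stmt-CriticalPhenomena-4575 --as helper`).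

* `PlanarSkeletonSign.BaseData₁` — gen 14's `PlanarSkeletonNeg.BaseData₁` (chart, Lipschitz, base vertices, frames, steps AT THE BASE VERTICES, connected
  UNIT cylinders at the base vertices, inversions) plus the axis flips; `toSign` (degree bound, steps everywhere, cylinders of every width derived —
  files VIII/X); **`BaseData₁.criticalContinuity`**: `θ_v(p_c) = 0` at every vertex, UNCONDITIONAL, any number of types.
* **`theta_criticalProb_eq_zero_of_base_vertices`** (UNCONDITIONAL, no structure in the statement): `G` locally finite; `φ : V → ℤ²` 1-Lipschitz
  along edges; a finite set `T` of base vertices such that every vertex is `α t` (`t ∈ T`) for an automorphism `α` with `φ ∘ α = φ + (φ(α t) − φ t)`;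
  at each `t ∈ T`: the four unit steps, the unit cylinder `G[{‖φ − φ t‖_∞ ≤ 1}]` connected, an automorphism fixing `t` reversing `φ − φ t`, and one
  fixing `t` reversing its second coordinate only.  THEN `θ_v(p_c) = 0` at every vertex `v`.  The one-type, flip-free sentence of gen 14
  (`theta_criticalProb_eq_zero_of_base_vertex`) is the other closed row.
* `theta_criticalProb_eq_zero_of_base_vertices_of_negNode`: the same without the flips, modulo the multi-type `{±1}` node.
* THREE ROWS FREED OF THEIR Φ2-ONLY HYPOTHESES: **`bsConj4_boxProd_skeleton_only`** — the PRODUCT RUNG of the class map, input-free: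
  `θ_{X □ Y}(v, p_c) = 0` for EVERY connected quasi-transitive `X` and EVERY `PlanarSkeletonConc` carrier `Y` (the hypotheses "Y of polynomial
  growth", "p_c(Y) < 1", "product cylinders subcritical" of `bsConj4_boxProd_of_skeletonConc` are gone); `LineSkeletonNeg.prod_criticalContinuity_skeleton_only` — `θ_{X □ Y}(v, p_c) = 0` for EVERY two
  graphs with one-dimensional reflectable skeletons (the transverse coordinate `τ` and the finite strips `hY` of `prod_criticalContinuity_holds`
  served Φ2 only); `PlanarSkeletonSign.continuous_theta_skeleton_only` — `p ↦ θ_v(p)` continuous on `[0,1]` on every subexponential-growth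
  `PlanarSkeletonSign` graph (the cylinder hypothesis of `ThetaCont.continuous_theta_of_planarSkeletonSign` is gone).
[cite: BenjaminiSchramm1996, Conj. 4] [cite: KozmaNitzan2024, §1 p. 2 (approach 1); §4 pp. 15–16 (Lemma 8)] [cite: AizenmanGrimmett1991, Thm 1]
-/

noncomputable section

namespace Summit.CriticalPhenomena.PercolationContinuityZ3.Theorems.Transplant

open SimpleGraph Literature.Probability.LatticeModels Literature.Probability.Percolation
open Literature.Barriers.CriticalPhenomena (IsQuasiTransitive HasExponentialGrowth countable_of_connected_of_locallyFinite)
open scoped Classical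

variable {V : Type} {G : SimpleGraph V} [G.LocallyFinite]

namespace PlanarSkeletonSign

/-- **Base-vertex data for a `PlanarSkeletonSign` with connected UNIT cylinders only**: `PlanarSkeletonNeg.BaseData₁` plus the axis flip at every
base vertex. [cite: KozmaNitzan2024, §4 p. 16 (Lemma 8)] -/
structure BaseData₁ (G : SimpleGraph V) [G.LocallyFinite] extends toNegBaseData₁ : PlanarSkeletonNeg.BaseData₁ G where
  /-- the axis flip at every base vertex: an automorphism fixing `t`, fixing the first and reversing the second relative coordinate -/
  flip : ∀ t ∈ types, ∃ α : G ≃g G, α t = t ∧ ∀ w, φ (α w) - φ t = flipSnd (φ w - φ t)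

namespace BaseData₁

variable (B : BaseData₁ G)

/-- **The `PlanarSkeletonSign` determined by base data with connected unit cylinders** (degree bound, steps everywhere and cylinders of every width
derived by files VIII/X). [cite: KozmaNitzan2024, §4 p. 16 (Lemma 8)] -/
def toSign : PlanarSkeletonSign G where
  toPlanarSkeletonNeg := B.toNegBaseData₁.toNeg
  flip := B.flip

end BaseData₁

/-- **THEOREM (unconditional).  Base data — any number of types — give `θ_v(p_c) = 0` at every vertex.**
builds on p205010 (kernel theorem, internal audit signed; external expert review pending). [cite: BenjaminiSchramm1996, Conj. 4] -/
theorem BaseData₁.criticalContinuity (B : BaseData₁ G) (v : V) : theta G v (criticalProbIOf G v) = 0 :=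
  B.toSign.criticalContinuity_skeleton_only v

end PlanarSkeletonSign

/-- **THEOREM (unconditional; the input sentence of record for the whole D″ class, unbundled, ANY number of base vertices).**
builds on p205010 (kernel theorem, internal audit signed; external expert review pending). [cite: BenjaminiSchramm1996, Conj. 4]
[cite: KozmaNitzan2024, §1 p. 2 (approach 1)] [cite: AizenmanGrimmett1991, Thm 1 (essential enhancements)] -/
theorem theta_criticalProb_eq_zero_of_base_vertices (φ : V → Site 2)
    (lip : ∀ ⦃u v : V⦄, G.Adj u v → ∀ i : Fin 2, |φ u i - φ v i| ≤ 1) (T : Finset V)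
    (frame : ∀ v : V, ∃ t ∈ T, ∃ α : G ≃g G, α t = v ∧ ∀ w, φ (α w) = φ w + (φ v - φ t))
    (step : ∀ t ∈ T, ∀ (i : Fin 2) (σ : ℤˣ), ∃ t' : V, G.Adj t t' ∧ φ t' = φ t + Pi.single i (σ : ℤ))
    (cyl₁ : ∀ t ∈ T, (G.induce {w | φ w - φ t ∈ box 2 1}).Connected)
    (neg : ∀ t ∈ T, ∃ α : G ≃g G, α t = t ∧ ∀ w, φ (α w) - φ t = -(φ w - φ t))
    (flip : ∀ t ∈ T, ∃ α : G ≃g G, α t = t ∧ ∀ w, φ (α w) - φ t = flipSnd (φ w - φ t)) (v : V) :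
    theta G v (criticalProbIOf G v) = 0 :=
  let B : PlanarSkeletonSign.BaseData₁ G :=
    { φ := φ, lip := lip, types := T, frame := frame, step_base := step, cyl1_connected := cyl₁, neg := neg, flip := flip }
  B.criticalContinuity v

/-- **The `{±1}` version, modulo the OPEN multi-type node `SamePDropOfSkeletonNeg`**: the same data WITHOUT the flips give `θ_v(p_c) = 0` at every
vertex if the node holds (Φ2, degree bound, steps, cylinders, `p_c < 1`, uniqueness all derived). [cite: BenjaminiSchramm1996, Conj. 4] -/
theorem theta_criticalProb_eq_zero_of_base_vertices_of_negNode (hD : SamePDropOfSkeletonNeg) (φ : V → Site 2)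
    (lip : ∀ ⦃u v : V⦄, G.Adj u v → ∀ i : Fin 2, |φ u i - φ v i| ≤ 1) (T : Finset V)
    (frame : ∀ v : V, ∃ t ∈ T, ∃ α : G ≃g G, α t = v ∧ ∀ w, φ (α w) = φ w + (φ v - φ t))
    (step : ∀ t ∈ T, ∀ (i : Fin 2) (σ : ℤˣ), ∃ t' : V, G.Adj t t' ∧ φ t' = φ t + Pi.single i (σ : ℤ))
    (cyl₁ : ∀ t ∈ T, (G.induce {w | φ w - φ t ∈ box 2 1}).Connected)
    (neg : ∀ t ∈ T, ∃ α : G ≃g G, α t = t ∧ ∀ w, φ (α w) - φ t = -(φ w - φ t)) (v : V) :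
    theta G v (criticalProbIOf G v) = 0 :=
  let B : PlanarSkeletonNeg.BaseData₁ G :=
    { φ := φ, lip := lip, types := T, frame := frame, step_base := step, cyl1_connected := cyl₁, neg := neg }
  B.toNeg.criticalContinuity_of_negNode hD v

/-! ## Three rows freed of their Φ2-only hypotheses -/

/-- **Benjamini–Schramm's Conjecture 4 for `X □ Y` — the PRODUCT RUNG of the class map, now INPUT-FREE and UNCONDITIONAL**: `X` connected,
locally finite, quasi-transitive (any growth); `Y` locally finite carrying a `PlanarSkeletonConc` ⟹ `θ_{X □ Y}(v, p_c) = 0` at EVERY vertex.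
The hypotheses "`Y` connected, quasi-transitive, of polynomial growth", "`p_c(Y) < 1`" and "product cylinders subcritical at `p_c`" of
`bsConj4_boxProd_of_skeletonConc` are gone: the product skeleton `Φ.boxProdLeft X hqX hcX` is a `PlanarSkeletonConc` on `X □ Y` and
`PlanarSkeletonConc.criticalContinuity_skeleton_only` applies (Φ2 by `cylSubcritical_criticalProb_ray`, uniqueness by Hutchcroft / Burton–Keane
inside the closed node's normal form).  builds on p205010 (kernel theorem, internal audit signed; external expert review pending).
[cite: BenjaminiSchramm1996, Conj. 4; §2 (almost transitive graphs)] [cite: Hutchcroft2016, Thm. 1] [cite: KozmaNitzan2024, §1 p. 2 (approach 1)] -/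
theorem bsConj4_boxProd_skeleton_only {W U : Type} [DecidableEq W] [DecidableEq U] (X : SimpleGraph W) [X.LocallyFinite]
    (hcX : X.Connected) (hqX : IsQuasiTransitive X) {Y : SimpleGraph U} [Y.LocallyFinite] (Φ : PlanarSkeletonConc Y) (v : W × U) :
    theta (X □ Y) v (criticalProbIOf (X □ Y) v) = 0 :=
  (Φ.boxProdLeft X hqX hcX).criticalContinuity_skeleton_only v


/-- **THEOREM (unconditional): `θ_{X □ Y}(v, p_c) = 0` at every vertex for EVERY two locally finite graphs carrying one-dimensional reflectable
skeletons** (`LineSkeletonNeg`; any number of types on each factor) — no transverse coordinate, no finite strips: those hypotheses of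
`LineSkeletonNeg.prod_criticalContinuity_holds` served Φ2 only, and Φ2 is now `PlanarSkeletonFrm.cylSubcritical_criticalProb_ray`.
builds on p205010 (kernel theorem, internal audit signed; external expert review pending). [cite: BenjaminiSchramm1996, Conj. 4] -/
theorem LineSkeletonNeg.prod_criticalContinuity_skeleton_only {V : Type} {X : SimpleGraph V} [X.LocallyFinite] (Ψ : LineSkeletonNeg X)
    {W : Type} {Y : SimpleGraph W} [Y.LocallyFinite] (Ψ' : LineSkeletonNeg Y) [(X □ Y).LocallyFinite] (v : V × W) :
    theta (X □ Y) v (criticalProbIOf (X □ Y) v) = 0 :=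
  (Ψ.prod Ψ').criticalContinuity_skeleton_only v

/-- **`p ↦ θ_v(p)` is continuous on `[0, 1]` at every vertex of every locally finite graph of subexponential growth carrying a `PlanarSkeletonSign`**
(any number of types; no cylinder hypothesis): `θ_v(p_c) = 0` by `criticalContinuity_skeleton_only`, uniqueness at every `p` by Burton–Keane on the
connected, quasi-transitive, amenable graph, van den Berg–Keane's criterion.  builds on p205010 (kernel theorem, internal audit signed; external expert
review pending). [cite: VandenBergKeane1984, Theorem] [cite: BenjaminiSchramm1996, Conj. 4] [cite: LyonsPeres2016, Thm. 7.6] -/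
theorem PlanarSkeletonSign.continuous_theta_skeleton_only (Φ : PlanarSkeletonSign G) (hG : ¬ HasExponentialGrowth G) (v : V) :
    Continuous fun p : unitInterval => theta G v p := by
  haveI : Countable V := countable_of_connected_of_locallyFinite G (Φ.toPlanarSkeletonNeg.toFrm.graph_connected v) v
  obtain ⟨t, ht, -⟩ := Φ.frame v
  exact (VdBK.continuous_theta_iff_of_unique G v fun p _ => Φ.toPlanarSkeletonNeg.toFrm.numInfiniteClusters_le_one hG ht p).2
    (Φ.criticalContinuity_skeleton_only v)

end Summit.CriticalPhenomena.PercolationContinuityZ3.Theorems.Transplant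

end
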